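import Summits.Ventures.YMGap.RobustBall.BoundaryFreeEnergy
import Summits.Ventures.YMGap.RobustBall.BoundaryDecayTorus
import Summits.Ventures.YMGap.Thresholds.PressureDerivativeSUN
import Summits.Ventures.YMGap.RobustBall.WilsonOneStateSymmetry
import HarnessLib

/-!
# Venture YMGap, track ROBUST-BALL — «C-DS-I» FOR EVERY `N ≥ 2` AND EVERY DIMENSION `d ≥ 2`: the free energy of a finite region of
# `ℤ^d` with an arbitrary boundary field is the volume term plus a boundary-uniform surface term, `SU(N)` Wilson at strong coupling

HONEST FRAMING. WHAT THIS IS: a venture file (cell `pub-ymgap`, track Y2 ROBUST-BALL / DS, seat ds-3, theorems only, 0 compute): the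
every-`N`, every-`d` cell of `BoundaryFreeEnergy.lean` («C-DS-I»). `SU(N)` lattice Yang–Mills on `ℤ^d` (`d ≥ 2`), Wilson action at tree
coupling `N β` ('t Hooft `β`), `0 ≤ β ≤ 1/(12(d−1))` and `β < 1/(8d)` (ds-1's every-`d` `C¹` window ∩ the sharp one-state window), ratio
`max(ρ, ½)` for any `6(d−1)β/(½ − 2(d−1)β) ≤ ρ < 1` (rb-p1's hypothesis-free Bakry–Émery single-link door in every dimension):
* `suN_integral_wilsonBoundaryAction_kernel` — `∫ S_Λ dγ_Λ^s(·|η) = Σ_{p∈T(Λ)} (N − ∫ Re tr U_p dγ_Λ^s(·|η))`;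
* `suN_abs_kernel_plaquette_sub_le` — per-plaquette boundary error `min (2N) (32 N⁴ √N · max(ρ,½)^{⌊D_p⌋})` at any depth `D_p` of the
  plaquette's links below the distance to the complement of `Λ` (the seat's `suN_wilson_boundary_dim4`);
* ★★ `suN_abs_log_normaliser_sub_freeEnergy_le` — for EVERY finite link volume `Λ`, EVERY boundary field `η` and depths `D_p` as above:
  `|log Z_Λ(Nβ|η) − (#T(Λ)/#planes(d))·f(Nβ)| ≤ Nβ · Σ_{p∈T(Λ)} min (2N) (32 N⁴ √N · max(ρ,½)^{⌊D_p⌋})`, `#planes(d) = d(d−1)/2`,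
  `f = freeEnergyDensity d ρ_N` — the Dobrushin–Shlosman Condition-I shape for every `N` and every `d` (in particular `d = 3`), HYPOTHESIS-FREE.
MECHANISM: as in the `SU(2)` file — the generic `hasDerivAt_log_normaliser`, ds-1's every-`N` thermodynamic identity
`PressureRegularity.hasDerivWithinAt_freeEnergyDensity_dim_thooft` (`f′(s) = −Σ_{i<j}(N − μ_s(Re tr U_{ij}))` on `[0, N/(12(d−1))]`), the
axis symmetry of the one state on the sharp window (`suN_wilson_oneState_symmetric_sharp`, `|β| < 1/(8d)`, + rb-p2's
`PlaquettePositivity.integral_plaquetteObs_eq`), the mean value inequality on `[0, Nβ]`, `log Z_Λ(0|η) = f(0) = 0`.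
WHAT THIS IS NOT: lattice strong coupling only; one-sided in `β` (the every-`N` identity of ds-1 is one-sided); constants are door
artefacts; nothing about the continuum limit or Clay. References: R. L. Dobrushin, S. B. Shlosman (1987), Condition I (statement shape);
the tree files named above. Everything here is proved. [folklore]
-/

noncomputable section

open MeasureTheory ProbabilityTheory Filter Topology Real Finset Set
open scoped NNReal
open Literature.Probability.LatticeModels hiding configShift configShift_apply
open Literature.MathematicalPhysics.QuantumLattice
open Literature.MathematicalPhysics.QuantumFieldTheory (IsLipschitzCylinder isLipschitzCylinder_zdPlaquetteObs zdPlaquetteObs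
  haarProbability card_plaquetteEdges_le)
open Summit.Ventures.YMGap.CouplingResponse (plaquetteObs_fundamentalRep_eq_mul_zdPlaquetteObs)

namespace Summit.Ventures.YMGap.RobustBall

namespace BoundaryFreeEnergy

variable {d N : ℕ}

/-- `SU(N)` is second countable. [folklore] -/
private theorem secondCountable_suN' : SecondCountableTopology (Matrix.specialUnitaryGroup (Fin N) ℂ) :=
  haveI : SecondCountableTopology (Matrix (Fin N) (Fin N) ℂ) :=
    inferInstanceAs (SecondCountableTopology (Fin N → Fin N → ℂ))
  Topology.IsEmbedding.subtypeVal.secondCountableTopology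

/-- The kernel energy is the sum of the plaquette terms, every `N`: `∫ S_Λ dγ_Λ^s(·|η) = Σ_{p ∈ T(Λ)} (N − ∫ Re tr U_p dγ_Λ^s(·|η))`.
[folklore] -/
theorem suN_integral_wilsonBoundaryAction_kernel (s : ℝ) (Λ : Finset (ZdEdge d)) (η : LGConfig d (SUN N)) :
    ∫ U, wilsonBoundaryAction (fundamentalRep (Fin N)) Λ U ∂(ymSpecification (d := d) (fundamentalRep (Fin N)) s Λ η) =
      ∑ p ∈ plaquettesTouching Λ, ((N : ℝ) - ∫ U, plaquetteObs (fundamentalRep (Fin N)) p.1 p.2.1.1 p.2.1.2 U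
        ∂(ymSpecification (d := d) (fundamentalRep (Fin N)) s Λ η)) := by
  haveI := secondCountable_suN' (N := N)
  have hρc : Continuous (fundamentalRep (Fin N)) := continuous_fundamentalRep (Fin N)
  haveI := isProbabilityMeasure_ymSpecification (fundamentalRep (Fin N)) hρc s Λ η
  have hWi : ∀ p : ZdPlaquette d, Integrable (fun U : LGConfig d (SUN N) =>
      plaquetteObs (fundamentalRep (Fin N)) p.1 p.2.1.1 p.2.1.2 U)
      (ymSpecification (d := d) (fundamentalRep (Fin N)) s Λ η) :=
    fun p => integrable_of_bound (continuous_plaquetteObs (fundamentalRep (Fin N)) hρc _ _ _).measurable.aestronglyMeasurable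
      (C := N) fun U =>
        abs_plaquetteObs_le_holds (fundamentalRep (Fin N)) fundamentalRep_mem_unitaryGroup p.1 p.2.1.1 p.2.1.2 U
  have hI : ∀ p ∈ plaquettesTouching Λ, Integrable (fun U : LGConfig d (SUN N) =>
      (N : ℝ) - plaquetteObs (fundamentalRep (Fin N)) p.1 p.2.1.1 p.2.1.2 U)
      (ymSpecification (d := d) (fundamentalRep (Fin N)) s Λ η) :=
    fun p _ => (integrable_const _).sub (hWi p)
  unfold wilsonBoundaryAction
  rw [integral_finsetSum _ hI]
  refine Finset.sum_congr rfl fun p _ => ?_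
  rw [integral_sub (integrable_const _) (hWi p), integral_const, smul_eq_mul, Measure.real, measure_univ, ENNReal.toReal_one,
    one_mul]

/-- **Per-plaquette boundary error, every `N ≥ 2`, every `d ≥ 1`** ('t Hooft `2(d−1)|β| < 1/2`, tree coupling `N β`,
`6(d−1)|β|/(½ − 2(d−1)|β|) ≤ ρ < 1`, `μ` a DLR state, `Λ` a finite volume with boundary field `η`, `p` ANY plaquette and `D` below the distance
from the links of `p` to the complement of `Λ`):
`|γ_Λ(Re tr U_p|η) − μ(Re tr U_p)| ≤ min (2N) (32 N⁴ √N · max(ρ,½)^{⌊D⌋})`. [folklore] -/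
theorem suN_abs_kernel_plaquette_sub_le (hd : 1 ≤ d) (hN : 2 ≤ N) {β ρ : ℝ} (hb : |β| * (2 * ((d : ℝ) - 1)) < 1 / 2)
    (hρ : 6 * ((d : ℝ) - 1) * |β| / (1 / 2 - |β| * (2 * ((d : ℝ) - 1))) ≤ ρ) (hρ1 : ρ < 1)
    {μ : Measure (LGConfig d (SUN N))} (hμ : μ ∈ ymGibbsMeasures (d := d) (fundamentalRep (Fin N)) (N * β))
    (Λ : Finset (ZdEdge d)) (η : LGConfig d (SUN N)) (p : ZdPlaquette d) {D : ℝ}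
    (hD : ∀ y ∈ plaquetteEdges p, ∀ z, z ∉ Λ → D ≤ ‖y.1 - z.1‖) :
    |(∫ U, plaquetteObs (fundamentalRep (Fin N)) p.1 p.2.1.1 p.2.1.2 U
          ∂(ymSpecification (d := d) (fundamentalRep (Fin N)) (N * β) Λ η)) -
        ∫ U, plaquetteObs (fundamentalRep (Fin N)) p.1 p.2.1.1 p.2.1.2 U ∂μ| ≤
      min (2 * (N : ℝ)) (32 * (N : ℝ) ^ 4 * Real.sqrt N * (max ρ (1 / 2)) ^ ⌊D⌋₊) := by
  haveI := secondCountable_suN' (N := N)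
  have hρc : Continuous (fundamentalRep (Fin N)) := continuous_fundamentalRep (Fin N)
  have hGibbs : IsGibbsMeasure (ymSpecification (d := d) (fundamentalRep (Fin N)) (N * β)) μ := hμ
  haveI := hGibbs.isProbabilityMeasure
  haveI := isProbabilityMeasure_ymSpecification (fundamentalRep (Fin N)) hρc (N * β) Λ η
  set W : LGConfig d (SUN N) → ℝ := fun U => plaquetteObs (fundamentalRep (Fin N)) p.1 p.2.1.1 p.2.1.2 U with hW
  have hWb : ∀ U, |W U| ≤ N := fun U =>
    abs_plaquetteObs_le_holds (fundamentalRep (Fin N)) fundamentalRep_mem_unitaryGroup p.1 p.2.1.1 p.2.1.2 U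
  have hint : ∀ (ν : Measure (LGConfig d (SUN N))) [IsProbabilityMeasure ν], |∫ U, W U ∂ν| ≤ N := fun ν _ => by
    have h := norm_integral_le_of_norm_le_const (μ := ν) (f := W) (C := (N : ℝ)) (ae_of_all _ fun U => by
      rw [Real.norm_eq_abs]; exact hWb U)
    simpa [Real.norm_eq_abs] using h
  have h2N : |(∫ U, W U ∂(ymSpecification (d := d) (fundamentalRep (Fin N)) (N * β) Λ η)) - ∫ U, W U ∂μ| ≤ 2 * (N : ℝ) := by
    calc |(∫ U, W U ∂(ymSpecification (d := d) (fundamentalRep (Fin N)) (N * β) Λ η)) - ∫ U, W U ∂μ|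
        ≤ |∫ U, W U ∂(ymSpecification (d := d) (fundamentalRep (Fin N)) (N * β) Λ η)| + |∫ U, W U ∂μ| := abs_sub _ _
      _ ≤ N + N := add_le_add (hint _) (hint _)
      _ = 2 * (N : ℝ) := by ring
  refine le_min h2N ?_
  obtain ⟨x, ⟨⟨i, j⟩, hij⟩⟩ := p
  have hF := isLipschitzCylinder_zdPlaquetteObs (d := d) (N := N) x hij
  have key := suN_wilson_boundary_bakryEmery hd hN hb hρ hρ1 hμ Λ η hF hD
  have hcard : ((plaquetteEdges ((x, ⟨(i, j), hij⟩) : ZdPlaquette d)).card : ℝ) ≤ 4 := by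
    exact_mod_cast card_plaquetteEdges_le _
  have hWeq : ∀ U, W U = N * zdPlaquetteObs (d := d) (fundamentalRep (Fin N)) x i j U := fun U =>
    plaquetteObs_fundamentalRep_eq_mul_zdPlaquetteObs x i j U
  have hI1 : (∫ U, W U ∂(ymSpecification (d := d) (fundamentalRep (Fin N)) (N * β) Λ η)) =
      N * ∫ U, zdPlaquetteObs (d := d) (fundamentalRep (Fin N)) x i j U
        ∂(ymSpecification (d := d) (fundamentalRep (Fin N)) (N * β) Λ η) := by
    rw [← integral_const_mul]; exact integral_congr_ae (ae_of_all _ hWeq)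
  have hI2 : (∫ U, W U ∂μ) = N * ∫ U, zdPlaquetteObs (d := d) (fundamentalRep (Fin N)) x i j U ∂μ := by
    rw [← integral_const_mul]; exact integral_congr_ae (ae_of_all _ hWeq)
  have hN0 : (0 : ℝ) ≤ N := Nat.cast_nonneg N
  have hq : (0 : ℝ) ≤ (max ρ (1 / 2)) ^ ⌊D⌋₊ := pow_nonneg (le_max_of_le_right (by norm_num)) _
  rw [hI1, hI2, ← mul_sub, abs_mul, Nat.abs_cast]
  calc (N : ℝ) * |(∫ U, zdPlaquetteObs (d := d) (fundamentalRep (Fin N)) x i j U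
            ∂(ymSpecification (d := d) (fundamentalRep (Fin N)) (N * β) Λ η)) -
          ∫ U, zdPlaquetteObs (d := d) (fundamentalRep (Fin N)) x i j U ∂μ|
      ≤ N * (2 * Real.sqrt N * ((4 * (N : ℝ≥0) ^ 3 : ℝ≥0) : ℝ) * (plaquetteEdges ((x, ⟨(i, j), hij⟩) : ZdPlaquette d)).card *
          (max ρ (1 / 2)) ^ ⌊D⌋₊) := mul_le_mul_of_nonneg_left key hN0
    _ ≤ N * (2 * Real.sqrt N * ((4 * (N : ℝ≥0) ^ 3 : ℝ≥0) : ℝ) * 4 * (max ρ (1 / 2)) ^ ⌊D⌋₊) := by gcongr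
    _ = 32 * (N : ℝ) ^ 4 * Real.sqrt N * (max ρ (1 / 2)) ^ ⌊D⌋₊ := by push_cast; ring

/-- ★★ **«C-DS-I» FOR EVERY `N ≥ 2` AND EVERY `d ≥ 2`** (Wilson action, 't Hooft `0 ≤ β ≤ 1/(12(d−1))`, `β < 1/(8d)`, tree coupling `N β`,
ratio `max(ρ,½)` with `6(d−1)β/(½ − 2(d−1)β) ≤ ρ < 1`): for every finite link volume `Λ ⊂ links(ℤ^d)`, EVERY boundary field `η` and depths `D_p`
with `D_p ≤ ‖y − z‖_∞` for every link `y` of `p` and every link `z ∉ Λ`: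
`|log Z_Λ(Nβ|η) − (#T(Λ)/#planes(d))·f(Nβ)| ≤ Nβ · Σ_{p∈T(Λ)} min (2N) (32 N⁴ √N · max(ρ,½)^{⌊D_p⌋})` — HYPOTHESIS-FREE. [folklore] -/
theorem suN_abs_log_normaliser_sub_freeEnergy_le (hd : 2 ≤ d) (hN : 2 ≤ N) {β ρ : ℝ} (hβ0 : 0 ≤ β)
    (hβ : β ≤ 1 / (12 * ((d : ℝ) - 1))) (hβ' : β < 1 / (8 * (d : ℝ)))
    (hρ : 6 * ((d : ℝ) - 1) * β / (1 / 2 - β * (2 * ((d : ℝ) - 1))) ≤ ρ) (hρ1 : ρ < 1) [DecidableEq (ZdEdge d)]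
    (Λ : Finset (ZdEdge d)) (η : LGConfig d (SUN N)) (D : ZdPlaquette d → ℝ)
    (hD : ∀ p ∈ plaquettesTouching Λ, ∀ y ∈ plaquetteEdges p, ∀ z, z ∉ Λ → D p ≤ ‖y.1 - z.1‖) :
    |Real.log (∫ ζ, Real.exp (-(N * β) * wilsonBoundaryAction (fundamentalRep (Fin N)) Λ (glueWith Λ ζ η))
          ∂(Measure.pi fun _ : ↥Λ => haarProbability (SUN N))) -
        (plaquettesTouching Λ).card / (Fintype.card {q : Fin d × Fin d // q.1 < q.2} : ℝ) *
          freeEnergyDensity d (fundamentalRep (Fin N)) (N * β)| ≤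
      N * β * ∑ p ∈ plaquettesTouching Λ,
        min (2 * (N : ℝ)) (32 * (N : ℝ) ^ 4 * Real.sqrt N * (max ρ (1 / 2)) ^ ⌊D p⌋₊) := by
  haveI := secondCountable_suN' (N := N)
  haveI : NeZero d := ⟨by omega⟩
  have hρc : Continuous (fundamentalRep (Fin N)) := continuous_fundamentalRep (Fin N)
  have hN0 : (0 : ℝ) < N := by exact_mod_cast (show 0 < N by omega)
  have hd2 : (2 : ℝ) ≤ d := by exact_mod_cast hd
  have hd0 : (0 : ℝ) < (d : ℝ) - 1 := by linarith
  -- the number of planes is positive (`d ≥ 2`)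
  have hcard_pos : (0 : ℝ) < (Fintype.card {q : Fin d × Fin d // q.1 < q.2} : ℝ) := by
    have : Nonempty {q : Fin d × Fin d // q.1 < q.2} := ⟨⟨(⟨0, by omega⟩, ⟨1, by omega⟩), by simp [Fin.lt_def]⟩⟩
    exact_mod_cast Fintype.card_pos
  set np : ℝ := (Fintype.card {q : Fin d × Fin d // q.1 < q.2} : ℝ) with hnp
  set T := plaquettesTouching Λ with hT
  set E : ℝ := ∑ p ∈ T, min (2 * (N : ℝ)) (32 * (N : ℝ) ^ 4 * Real.sqrt N * (max ρ (1 / 2)) ^ ⌊D p⌋₊) with hE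
  set LZ : ℝ → ℝ := fun s => Real.log (∫ ζ, Real.exp (-s * wilsonBoundaryAction (fundamentalRep (Fin N)) Λ (glueWith Λ ζ η))
      ∂(Measure.pi fun _ : ↥Λ => haarProbability (SUN N))) with hLZ
  set f : ℝ → ℝ := freeEnergyDensity d (fundamentalRep (Fin N)) with hf
  set D' : ℝ → ℝ := fun s => LZ s - (T.card : ℝ) / np * f s with hD'
  set w : ℝ := (N : ℝ) / (12 * ((d : ℝ) - 1)) with hw
  have hwin : (N : ℝ) * β ≤ w := by
    rw [hw, le_div_iff₀ (by positivity)]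
    have h1 : β * (12 * ((d : ℝ) - 1)) ≤ 1 := by rw [le_div_iff₀ (by positivity)] at hβ; linarith
    nlinarith
  -- a DLR selection on the `C¹` window: the symmetric one state where the sharp window allows it, any DLR state elsewhere
  have hex : ∀ s : ℝ, ∃ ν : Measure (LGConfig d (SUN N)),
      (s ∈ Icc (0 : ℝ) w → ν ∈ ymGibbsMeasures (d := d) (fundamentalRep (Fin N)) s) ∧
      (s ∈ Icc (0 : ℝ) (N * β) → ν ∈ infiniteVolumeLimitPoints (d := d) (fundamentalRep (Fin N)) s) := by
    intro s
    by_cases hs : s ∈ Icc (0 : ℝ) (N * β)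
    · have hβs : |s / N| < HessianSharp.sharpThresholdSU d := by
        rw [HessianSharp.sharpThresholdSU, abs_of_nonneg (div_nonneg hs.1 hN0.le), div_lt_iff₀ hN0]
        have h1 : β * (8 * (d : ℝ)) < 1 := by rw [lt_div_iff₀ (by positivity)] at hβ'; linarith
        rw [div_mul_eq_mul_div, lt_div_iff₀ (by positivity : (0 : ℝ) < 8 * d), one_mul]
        nlinarith [hs.2]
      obtain ⟨ν, h1, h2, -, -⟩ := suN_wilson_oneState_symmetric_sharp (d := d) (N := N) hd hN hβs
      have e : (N : ℝ) * (s / N) = s := by field_simp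
      rw [e] at h1 h2
      exact ⟨ν, fun _ => by rw [h1]; exact Set.mem_singleton _, fun _ => by rw [h2]; exact Set.mem_singleton _⟩
    · by_cases hs' : s ∈ Icc (0 : ℝ) w
      · obtain ⟨ν, hν⟩ := Literature.MathematicalPhysics.QuantumFieldTheory.ymGibbsMeasures_nonempty (d := d)
          (fundamentalRep (Fin N)) hρc s
        exact ⟨ν, fun _ => hν, fun h => absurd h hs⟩
      · exact ⟨0, fun h => absurd h hs', fun h => absurd h hs⟩
  choose ν hνG hνL using hex
  have hplane : ∀ s ∈ Icc (0 : ℝ) (N * β), ∀ (y : Site d) (i j : Fin d), i ≠ j →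
      ∫ U, plaquetteObs (fundamentalRep (Fin N)) y i j U ∂(ν s) = ∫ U, plaquetteObs (fundamentalRep (Fin N)) 0 0 1 U ∂(ν s) :=
    fun s hs y i j hij => PlaquettePositivity.integral_plaquetteObs_eq (fundamentalRep (Fin N)) hρc hd (hνL s hs) y hij
  have hsub : Icc (0 : ℝ) (N * β) ⊆ Icc (0 : ℝ) w := Icc_subset_Icc_right hwin
  -- the derivative of `D'` on `[0, Nβ]` within the `C¹` window
  have hDer : ∀ s ∈ Icc (0 : ℝ) (N * β), HasDerivWithinAt D'
      (∑ p ∈ T, ((∫ U, plaquetteObs (fundamentalRep (Fin N)) p.1 p.2.1.1 p.2.1.2 U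
          ∂(ymSpecification (d := d) (fundamentalRep (Fin N)) s Λ η)) -
        ∫ U, plaquetteObs (fundamentalRep (Fin N)) p.1 p.2.1.1 p.2.1.2 U ∂(ν s))) (Icc (0 : ℝ) w) s := by
    intro s hs
    have h1 : HasDerivWithinAt LZ (-(∫ U, wilsonBoundaryAction (fundamentalRep (Fin N)) Λ U
        ∂(ymSpecification (d := d) (fundamentalRep (Fin N)) s Λ η))) (Icc (0 : ℝ) w) s :=
      (hasDerivAt_log_normaliser (fundamentalRep (Fin N)) hρc Λ η s).hasDerivWithinAt
    have h2 := PressureRegularity.hasDerivWithinAt_freeEnergyDensity_dim_thooft hd hN hνG (hsub hs)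
    refine (h1.fun_sub (h2.const_mul ((T.card : ℝ) / np))).congr_deriv ?_
    rw [suN_integral_wilsonBoundaryAction_kernel]
    have hq : ∑ q : {q : Fin d × Fin d // q.1 < q.2},
        ((N : ℝ) - ∫ U, plaquetteObs (fundamentalRep (Fin N)) 0 q.1.1 q.1.2 U ∂(ν s)) =
        np * (N - ∫ U, plaquetteObs (fundamentalRep (Fin N)) 0 0 1 U ∂(ν s)) := by
      rw [Finset.sum_congr rfl fun q _ => by rw [hplane s hs 0 q.1.1 q.1.2 (ne_of_lt q.2)], Finset.sum_const, Finset.card_univ,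
        nsmul_eq_mul]
    have hp : ∀ p ∈ T, ∫ U, plaquetteObs (fundamentalRep (Fin N)) p.1 p.2.1.1 p.2.1.2 U ∂(ν s) =
        ∫ U, plaquetteObs (fundamentalRep (Fin N)) 0 0 1 U ∂(ν s) := fun p _ => hplane s hs p.1 _ _ (ne_of_lt p.2.2)
    rw [hq, Finset.sum_sub_distrib, Finset.sum_sub_distrib, Finset.sum_congr rfl hp, Finset.sum_const, Finset.sum_const,
      nsmul_eq_mul, nsmul_eq_mul]
    field_simp
    ring
  -- the derivative is bounded by `E` on `[0, N β]`
  have hbd : ∀ s ∈ Icc (0 : ℝ) (N * β),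
      ‖∑ p ∈ T, ((∫ U, plaquetteObs (fundamentalRep (Fin N)) p.1 p.2.1.1 p.2.1.2 U
          ∂(ymSpecification (d := d) (fundamentalRep (Fin N)) s Λ η)) -
        ∫ U, plaquetteObs (fundamentalRep (Fin N)) p.1 p.2.1.1 p.2.1.2 U ∂(ν s))‖ ≤ E := by
    intro s hs
    set β' : ℝ := s / N with hβ'def
    have hsN : (N : ℝ) * β' = s := by rw [hβ'def]; field_simp
    have hβ'0 : 0 ≤ β' := by rw [hβ'def]; exact div_nonneg hs.1 hN0.le
    have hβ'le : β' ≤ β := by rw [hβ'def, div_le_iff₀ hN0]; linarith [hs.2]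
    have h12 : β * (12 * ((d : ℝ) - 1)) ≤ 1 := by rw [le_div_iff₀ (by positivity)] at hβ; linarith
    have hb' : |β'| * (2 * ((d : ℝ) - 1)) < 1 / 2 := by rw [abs_of_nonneg hβ'0]; nlinarith
    have hρ' : 6 * ((d : ℝ) - 1) * |β'| / (1 / 2 - |β'| * (2 * ((d : ℝ) - 1))) ≤ ρ := by
      rw [abs_of_nonneg hβ'0]
      refine le_trans ?_ hρ
      have hden : 0 < 1 / 2 - β * (2 * ((d : ℝ) - 1)) := by nlinarith
      have hden' : 0 < 1 / 2 - β' * (2 * ((d : ℝ) - 1)) := by nlinarith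
      rw [div_le_div_iff₀ hden' hden]
      nlinarith [mul_nonneg hβ'0 hd0.le, mul_nonneg hβ0 hd0.le]
    have hμs : ν s ∈ ymGibbsMeasures (d := d) (fundamentalRep (Fin N)) (N * β') := by rw [hsN]; exact hνG s (hsub hs)
    rw [Real.norm_eq_abs]
    refine (Finset.abs_sum_le_sum_abs _ _).trans (Finset.sum_le_sum fun p hp => ?_)
    have h := suN_abs_kernel_plaquette_sub_le (by omega) hN hb' hρ' hρ1 hμs Λ η p (hD p hp)
    rwa [hsN] at h
  have hNβ : 0 ≤ (N : ℝ) * β := by positivity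
  have hMVT := Convex.norm_image_sub_le_of_norm_hasDerivWithin_le (f := D') (s := Icc (0 : ℝ) (N * β))
    (fun s hs => (hDer s hs).mono hsub) hbd (convex_Icc _ _) (left_mem_Icc.2 hNβ) (right_mem_Icc.2 hNβ)
  have hLZ0 : LZ 0 = 0 := log_normaliser_zero (fundamentalRep (Fin N)) Λ η
  have hf0 : f 0 = 0 := by
    have h := FreeEnergyLaw.freeEnergyDensity_two_sided (d := d) (fundamentalRep (Fin N))
      (Literature.MathematicalPhysics.QuantumFieldTheory.TorusAreaLaw.isSpecialUnitaryModel_fundamentalRep N) hN hd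
      (le_refl (0 : ℝ))
    simp only [mul_zero, zero_pow two_ne_zero, zero_div, add_zero, neg_zero, Real.exp_zero, mul_one] at h
    exact le_antisymm h.2 h.1
  have hD0 : D' 0 = 0 := by
    show LZ 0 - (T.card : ℝ) / np * f 0 = 0
    rw [hLZ0, hf0]; ring
  rw [hD0, sub_zero, sub_zero, Real.norm_eq_abs, Real.norm_eq_abs, abs_of_nonneg hNβ] at hMVT
  calc |D' (N * β)| ≤ E * (N * β) := hMVT
    _ = N * β * E := mul_comm _ _

end BoundaryFreeEnergy

end Summit.Ventures.YMGap.RobustBall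

end
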